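import Literature.Topology.FourManifolds.ProjectiveTowers
import Literature.Topology.FourManifolds.SmoothOrientationConnectedProofs
import Literature.Uncategorized.Crux
import Summits.SmoothPoincare4.SmoothPoincare4.Theorems.ZeroSurgeryExoticZseSVanishesOnPairsPairSphereData
import Summits.SmoothPoincare4.SmoothPoincare4.Theorems.ZeroSurgeryExoticZseSVanishesOnPairsTransportPuncture
import Summits.SmoothPoincare4.SmoothPoincare4.Theorems.ZeroSurgeryExoticZseSVanishesOnPairsChartOrientation
import Summits.SmoothPoincare4.SmoothPoincare4.Theorems.ZeroSurgeryExoticZseSVanishesOnPairsMirrorChart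
import Summits.SmoothPoincare4.SmoothPoincare4.Theorems.ZseSVanishesOnPairs.Negative.MirrorClosure
import Summits.SmoothPoincare4.SmoothPoincare4.Statement
import Summits.SmoothPoincare4.SmoothPoincare4.Theorems.ZeroSurgeryExoticZseSVanishesOnPairsEmbedDontDissolveDefs
import Literature.Topology.FourManifolds.OrientedConnectedSumAssoc
import HarnessLib

/-!
# Line `embed-dont-dissolve` for crux `ZseSVanishesOnPairs` (stmt-SmoothPoincare4-0368): the kernel-checked reduction

The crux (`Literature.Uncategorized.SVanishesOnPairs` = ledger signature of item stmt-SmoothPoincare4-0368 verbatim: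
on a `0`-surgery pair `(K, K', Y)` with `K` smoothly slice every Rasmussen invariant of `K'` vanishes) FOLLOWS from

* the ENGINE — MMSW 2023 Cor. 1.9, knot case, as the Literature named fact
  `Knot.rasmussen_nonpos_of_isTowerSlice` (for one orientation `o` of `ℂℙ²`, every knot tower-slice over `o` has
  `s ≤ 0`), taken as a hypothesis; and
* the BET of the line (hypothesis `hbet`, spelled out; it is the registered stub `stub_puncturedPairSphereEmbeds`
  of the crux skeleton `Cruxes/ZseSVanishesOnPairs/Lines/embed_dont_dissolve.lean`, an OPEN statement lying between
  `SmoothPoincare4` and the crux): for one orientation `o` of `ℂℙ²`, every Manolescu–Piccirillo pair-sphere datum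
  `(g, X, e, f, j, oX, q)` — a slice disc `g` of `K`, a closed smooth `X ≃ₕ S⁴` with slice data `(e, f)` for `K'`,
  a smooth embedding `j` of the open slice-disc exterior onto `X ∖ (e(𝔻⁴) ∪ f(𝔻²))`, an orientation `oX` making
  the ball chart `e` orientation preserving, a point `q` — has its puncture `(X ∖ {q}, oX)` smoothly and
  orientation-preservingly embedded in some `o`-tower `#ᵗ(ℂℙ², o)` (`IsProjectiveTower`).

Everything between these two hypotheses and the crux is PROVED here from the four ACCEPTED stub files of the line
(`stub_pairSphereData` p78044, `stub_chartOrientation` p78557, `stub_sliceDiscIn_transport_puncture` p78588,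
`stub_sliceDiscIn_mirror_chart` p78836), the mirror closure of the class of pairs (`Negative.MirrorClosure`,
p76282) and `SmoothOrientation.eq_or_eq_neg_of_connectedSpace_holds` (the bet's `o₁` is `±` the engine's `o₀`):
`isTowerSlice_of_puncturedEmbedding` (transport), `Knot.IsTowerSlice.mirror` (chirality flip), and the reduction
`sVanishesOnPairs_of_towerEngine_of_puncturedPairSpheresEmbed`.  No `sorry`, no new definition; the theorem is
an implication (the crux item stays open: its two antecedents are the undischarged named fact and the open bet).

APPENDED (same seat, after the Defs file `ZeroSurgeryExoticZseSVanishesOnPairsEmbedDontDissolveDefs.lean` named the bet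
per orientation as `PuncturedPairSpheresEmbedIn o`, punctures OFF the data): the reduction against the named bet
(`sVanishesOnPairs_of_towerEngine_of_puncturedPairSpheresEmbedIn`, `…_of_exists_puncturedPairSpheresEmbedIn`), the
calibration `puncturedPairSpheresEmbedIn_of_spc4` (`SmoothPoincare4 ⇒` the bet for EVERY `o`, height `0`) and the
composite `sVanishesOnPairs_of_towerEngine_of_spc4` — the line's position `SPC4 ⇒ ∀ o bet ⇒ crux (mod engine)`,
kernel-checked.
-/

noncomputable section

set_option linter.dupNamespace false

open scoped Manifold ContDiff Topology
open Set Function ContinuousMap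
open Literature.Topology.FourManifolds

namespace Summit.SmoothPoincare4.SmoothPoincare4.Theorems.ZseSVanishesOnPairs

/-- **Transport: a punctured embedding of the ambient homotopy sphere into an `o`-tower makes the knot
tower-slice over `o`.**  If `K` has slice data `(e, f)` in a closed smooth `X ≃ₕ S⁴`, `e` is orientation
preserving for `oX`, `q ∉ e(ℝ⁴) ∪ f(ℝ²)`, and `(X ∖ {q}, oX)` embeds smoothly and orientation-preservingly in an
`o`-tower `(P, oP)` of some height, then `K.IsTowerSlice o` (the transported data lie in the image of the
punctured homotopy sphere, an open set with `H₂ = 0`; this is `stub_sliceDiscIn_transport_puncture`).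
[cite: ManolescuPiccirillo2023, Def. 2.1 and §2] -/
theorem isTowerSlice_of_puncturedEmbedding (o : SmoothOrientation (𝓡 4) ComplexProjectivePlane) (K : Knot)
    (X : Type) [TopologicalSpace X] [T2Space X] [SecondCountableTopology X] [ChartedSpace (EuclideanSpace ℝ (Fin 4)) X]
    [IsManifold (𝓡 4) ∞ X] [CompactSpace X] (oX : SmoothOrientation (𝓡 4) X) (e : EuclideanSpace ℝ (Fin 4) → X) (f : EuclideanSpace ℝ (Fin 2) → X)
    (q : X) (hX : Nonempty (X ≃ₕ (Metric.sphere (0 : EuclideanSpace ℝ (Fin 5)) 1))) (hef : K.IsSliceDiscIn X e f)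
    (he : IsOrientationPreserving (SmoothOrientation.euclidean 4) oX e) (hq : q ∉ range e) (hqf : q ∉ range f)
    (t : ℕ) (P : Type) [TopologicalSpace P] [T2Space P] [SecondCountableTopology P] [ChartedSpace (EuclideanSpace ℝ (Fin 4)) P]
    [IsManifold (𝓡 4) ∞ P] [CompactSpace P] (oP : SmoothOrientation (𝓡 4) P)
    (jP : ↥((⟨{q}ᶜ, isOpen_compl_singleton⟩ : TopologicalSpace.Opens X)) → P)
    (hT : IsProjectiveTower o t P oP) (hj : Manifold.IsSmoothEmbedding (𝓡 4) (𝓡 4) ∞ jP)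
    (hjo : IsOrientationPreserving (oX.restrict (⟨{q}ᶜ, isOpen_compl_singleton⟩ : TopologicalSpace.Opens X)) oP jP) :
    K.IsTowerSlice o := by
  obtain ⟨e', f', hef', he', U, heU, hfU, hU⟩ :=
    stub_sliceDiscIn_transport_puncture K X oX e f q hX hef he hq hqf P oP jP hj hjo
  exact ⟨t, P, _, ‹_›, ‹_›, _, ‹_›, ‹_›, oP, e', f', hT, hef', he', U, heU, hfU, hU⟩

/-- **Chirality flip: tower-slice over `o` ⇒ the mirror is tower-slice over `-o`** (reflect the ball chart:
`stub_sliceDiscIn_mirror_chart`; reverse the tower: `IsProjectiveTower.neg`).  Tree form of MMSW Remark 6.6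
("`L` is strongly H-slice in `ℂℙ²bar` iff `L̄` is strongly slice in `ℂℙ²`").
[cite: ManolescuMarengonSarkarWillis2023, §6.1, Remark 6.6] -/
theorem _root_.Literature.Topology.FourManifolds.Knot.IsTowerSlice.mirror {o : SmoothOrientation (𝓡 4) ComplexProjectivePlane}
    {K : Knot} (h : K.IsTowerSlice o) : K.mirror.IsTowerSlice (-o) := by
  obtain ⟨t, P, _, _, _, _, _, _, oP, e, f, hT, hef, he, U, heU, hfU, hU⟩ := h
  obtain ⟨hm, hmo, _⟩ := stub_sliceDiscIn_mirror_chart K P oP e f hef he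
  exact ⟨t, P, _, ‹_›, ‹_›, _, ‹_›, ‹_›, -oP, e ∘ reflectLastCLM 3, f, IsProjectiveTower.neg o t P oP hT, hm, hmo,
    U, fun v => heU _, hfU, hU⟩

/-- Tower-slice over `-o` ⇒ the mirror is tower-slice over `o` (the flip read backwards, `- -o = o`).
[cite: ManolescuMarengonSarkarWillis2023, §6.1, Remark 6.6] -/
theorem _root_.Literature.Topology.FourManifolds.Knot.IsTowerSlice.mirror_of_neg {o : SmoothOrientation (𝓡 4) ComplexProjectivePlane}
    {K : Knot} (h : K.IsTowerSlice (-o)) : K.mirror.IsTowerSlice o := by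
  simpa using h.mirror

/-- **One-sided bound from tower-sliceness of every partner.**  If for the engine's orientation `o` every
`K'` that is `0`-surgery-related to a smoothly slice `K` is tower-slice over `o`, then `s(K') ≤ 0` on all such
pairs, hence (mirror closure `Negative.sVanishesOnPairs_iff_nonpos`) the crux.
[cite: ManolescuMarengonSarkarWillis2023, Cor. 1.9] -/
theorem sVanishesOnPairs_of_isTowerSlice_on_pairs (o : SmoothOrientation (𝓡 4) ComplexProjectivePlane)
    (hengine : ∀ (K : Knot), K.IsTowerSlice o → ∀ s : ℤ, K.HasRasmussenInvariant s → s ≤ 0)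
    (hT : ∀ (K K' : Knot) (Y : Type) [TopologicalSpace Y] [ChartedSpace (EuclideanSpace ℝ (Fin 3)) Y],
      IsIntegralSurgery (𝓡 3) Y K 0 → IsIntegralSurgery (𝓡 3) Y K' 0 → K.IsSmoothlySlice → K'.IsTowerSlice o) :
    Literature.Uncategorized.SVanishesOnPairs :=
  Negative.sVanishesOnPairs_iff_nonpos.2 fun K K' Y _ _ s h1 h2 h3 h4 =>
    hengine K' (hT K K' Y h1 h2 h3) s h4

/-- **The mirrored one-sided bound.**  If every partner is tower-slice over the OPPOSITE orientation `-o` of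
the engine's `o`, then every mirrored partner is tower-slice over `o`, so `-s(K') ≤ 0` on all pairs, hence
(mirror closure `Negative.sVanishesOnPairs_iff_nonneg`) the crux.
[cite: ManolescuMarengonSarkarWillis2023, Cor. 1.9 and Remark 6.6] -/
theorem sVanishesOnPairs_of_isTowerSlice_neg_on_pairs (o : SmoothOrientation (𝓡 4) ComplexProjectivePlane)
    (hengine : ∀ (K : Knot), K.IsTowerSlice o → ∀ s : ℤ, K.HasRasmussenInvariant s → s ≤ 0)
    (hT : ∀ (K K' : Knot) (Y : Type) [TopologicalSpace Y] [ChartedSpace (EuclideanSpace ℝ (Fin 3)) Y],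
      IsIntegralSurgery (𝓡 3) Y K 0 → IsIntegralSurgery (𝓡 3) Y K' 0 → K.IsSmoothlySlice → K'.IsTowerSlice (-o)) :
    Literature.Uncategorized.SVanishesOnPairs :=
  Negative.sVanishesOnPairs_iff_nonneg.2 fun K K' Y _ _ s h1 h2 h3 h4 => by
    have h := hengine K'.mirror (hT K K' Y h1 h2 h3).mirror_of_neg (-s) (HasRasmussenInvariant.mirror_holds h4)
    omega

/-- **THE REDUCTION (line `embed-dont-dissolve`, kernel-checked): ENGINE ∧ BET ⇒ CRUX.**  Hypotheses: the named
fact `Knot.rasmussen_nonpos_of_isTowerSlice` (MMSW 2023 Cor. 1.9, knot case: for SOME orientation `o₀` of `ℂℙ²`,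
tower-slice over `o₀` ⇒ `s ≤ 0`) and the line's bet for SOME orientation `o₁` (every Manolescu–Piccirillo pair-sphere
datum has its puncture embedded orientation-preservingly in an `o₁`-tower).  Proof: on a pair `(K, K', Y)` with `K`
slice, `stub_pairSphereData` produces the datum, `stub_chartOrientation` orients it, the bet embeds the puncture, and
`isTowerSlice_of_puncturedEmbedding` makes `K'` tower-slice over `o₁`; `ℂℙ²` being connected, `o₁ = o₀` or `o₁ = -o₀`
(`SmoothOrientation.eq_or_eq_neg_of_connectedSpace_holds`), and the two one-sided lemmas finish.  The conclusion is
the crux under its tree name (= route item stmt-SmoothPoincare4-0368 verbatim); the theorem closes nothing by itself —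
it records exactly what the line still owes: the engine (published, undischarged) and the bet (open).
[cite: ManolescuMarengonSarkarWillis2023, Cor. 1.9, Remark 6.6 and Question 9.11] [cite: ManolescuPiccirillo2023, Lemma 3.3 and Def. 2.4] -/
theorem sVanishesOnPairs_of_towerEngine_of_puncturedPairSpheresEmbed
    (hengine : Knot.rasmussen_nonpos_of_isTowerSlice)
    (hbet : ∃ o : SmoothOrientation (𝓡 4) ComplexProjectivePlane, ∀ (K K' : Knot) (g : EuclideanSpace ℝ (Fin 2) → EuclideanSpace ℝ (Fin 4)) (X : Type) [TopologicalSpace X]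
      [T2Space X] [SecondCountableTopology X] [ChartedSpace (EuclideanSpace ℝ (Fin 4)) X] [IsManifold (𝓡 4) ∞ X] [CompactSpace X]
      (e : EuclideanSpace ℝ (Fin 4) → X) (f : EuclideanSpace ℝ (Fin 2) → X) (j : sliceDiscExterior g → X) (oX : SmoothOrientation (𝓡 4) X) (q : X),
      Nonempty (X ≃ₕ (Metric.sphere (0 : EuclideanSpace ℝ (Fin 5)) 1)) → K.IsSliceDisc g → K'.IsSliceDiscIn X e f →
      Manifold.IsSmoothEmbedding (𝓡 4) (𝓡 4) ∞ j →
      range j = (e '' Metric.closedBall (0 : EuclideanSpace ℝ (Fin 4)) 1 ∪ f '' Metric.closedBall (0 : EuclideanSpace ℝ (Fin 2)) 1)ᶜ →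
      IsOrientationPreserving (SmoothOrientation.euclidean 4) oX e →
      ∃ (t : ℕ) (P : Type) (_ : TopologicalSpace P) (_ : T2Space P) (_ : SecondCountableTopology P)
        (_ : ChartedSpace (EuclideanSpace ℝ (Fin 4)) P) (_ : IsManifold (𝓡 4) ∞ P) (_ : CompactSpace P)
        (oP : SmoothOrientation (𝓡 4) P) (jP : ↥((⟨{q}ᶜ, isOpen_compl_singleton⟩ : TopologicalSpace.Opens X)) → P),
        IsProjectiveTower o t P oP ∧ Manifold.IsSmoothEmbedding (𝓡 4) (𝓡 4) ∞ jP ∧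
          IsOrientationPreserving (oX.restrict (⟨{q}ᶜ, isOpen_compl_singleton⟩ : TopologicalSpace.Opens X)) oP jP) :
    Literature.Uncategorized.SVanishesOnPairs := by
  obtain ⟨o₀, h₀⟩ := hengine
  obtain ⟨o₁, h₁⟩ := hbet
  -- every partner of a slice knot is tower-slice over the bet's orientation `o₁`
  have hT : ∀ (K K' : Knot) (Y : Type) [TopologicalSpace Y] [ChartedSpace (EuclideanSpace ℝ (Fin 3)) Y],
      IsIntegralSurgery (𝓡 3) Y K 0 → IsIntegralSurgery (𝓡 3) Y K' 0 → K.IsSmoothlySlice →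
        K'.IsTowerSlice o₁ := by
    intro K K' Y _ _ hK hK' hsl
    obtain ⟨g, X, _, _, _, _, _, _, e, f, j, q, hX, hg, hef, hj, hrange, hq, hq'⟩ :=
      stub_pairSphereData K K' Y hK hK' hsl
    obtain ⟨oX, he⟩ := stub_chartOrientation X e hX hef.isSmoothEmbedding
    obtain ⟨t, P, _, _, _, _, _, _, oP, jP, hP, hjP, hjo⟩ := h₁ K K' g X e f j oX q hX hg hef hj hrange he
    exact isTowerSlice_of_puncturedEmbedding o₁ K' X oX e f q hX hef he hq hq' t P oP jP hP hjP hjo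
  rcases SmoothOrientation.eq_or_eq_neg_of_connectedSpace_holds o₀ o₁ with h | h
  · exact sVanishesOnPairs_of_isTowerSlice_on_pairs o₀ h₀ fun K K' Y _ _ hK hK' hsl => h ▸ hT K K' Y hK hK' hsl
  · exact sVanishesOnPairs_of_isTowerSlice_neg_on_pairs o₀ h₀ fun K K' Y _ _ hK hK' hsl => h ▸ hT K K' Y hK hK' hsl

/-! ## Against the named bet `PuncturedPairSpheresEmbedIn o` (Defs file of the line) -/

/-- **THE REDUCTION against the named bet**: the engine (named fact `Knot.rasmussen_nonpos_of_isTowerSlice`, MMSW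
2023 Cor. 1.9) and the line's bet for ONE orientation `o` (`PuncturedPairSpheresEmbedIn o`: punctures OFF the slice
data embed in `o`-towers — the sharpened form, all that is consumed) imply the crux.  Same proof as
`sVanishesOnPairs_of_towerEngine_of_puncturedPairSpheresEmbed`, feeding the bet the point `q ∉ e(ℝ⁴) ∪ f(ℝ²)` of
`stub_pairSphereData`. [cite: ManolescuMarengonSarkarWillis2023, Cor. 1.9, Remark 6.6 and Question 9.11] -/
theorem sVanishesOnPairs_of_towerEngine_of_puncturedPairSpheresEmbedIn
    (hengine : Knot.rasmussen_nonpos_of_isTowerSlice) {o : SmoothOrientation (𝓡 4) ComplexProjectivePlane}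
    (hbet : PuncturedPairSpheresEmbedIn o) : Literature.Uncategorized.SVanishesOnPairs := by
  obtain ⟨o₀, h₀⟩ := hengine
  have hT : ∀ (K K' : Knot) (Y : Type) [TopologicalSpace Y] [ChartedSpace (EuclideanSpace ℝ (Fin 3)) Y],
      IsIntegralSurgery (𝓡 3) Y K 0 → IsIntegralSurgery (𝓡 3) Y K' 0 → K.IsSmoothlySlice →
        K'.IsTowerSlice o := by
    intro K K' Y _ _ hK hK' hsl
    obtain ⟨g, X, _, _, _, _, _, _, e, f, j, q, hX, hg, hef, hj, hrange, hq, hq'⟩ :=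
      stub_pairSphereData K K' Y hK hK' hsl
    obtain ⟨oX, he⟩ := stub_chartOrientation X e hX hef.isSmoothEmbedding
    obtain ⟨t, P, _, _, _, _, _, _, oP, jP, hP, hjP, hjo⟩ :=
      hbet K K' g X e f j oX q hX hg hef hj hrange he hq hq'
    exact isTowerSlice_of_puncturedEmbedding o K' X oX e f q hX hef he hq hq' t P oP jP hP hjP hjo
  rcases SmoothOrientation.eq_or_eq_neg_of_connectedSpace_holds o₀ o with h | h
  · exact sVanishesOnPairs_of_isTowerSlice_on_pairs o₀ h₀ fun K K' Y _ _ hK hK' hsl => h ▸ hT K K' Y hK hK' hsl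
  · exact sVanishesOnPairs_of_isTowerSlice_neg_on_pairs o₀ h₀ fun K K' Y _ _ hK hK' hsl => h ▸ hT K K' Y hK hK' hsl

/-- **The `∃ o` form**: engine ∧ (`∃ o, PuncturedPairSpheresEmbedIn o`) ⇒ crux — the registered bet
`stub_puncturedPairSphereEmbeds` of the skeleton is literally `∃ o, PuncturedPairSpheresEmbedIn o` after unfolding its
local abbreviations. [cite: ManolescuMarengonSarkarWillis2023, Cor. 1.9 and Question 9.11] -/
theorem sVanishesOnPairs_of_towerEngine_of_exists_puncturedPairSpheresEmbedIn
    (hengine : Knot.rasmussen_nonpos_of_isTowerSlice)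
    (hbet : ∃ o : SmoothOrientation (𝓡 4) ComplexProjectivePlane, PuncturedPairSpheresEmbedIn o) :
    Literature.Uncategorized.SVanishesOnPairs := by
  obtain ⟨o, ho⟩ := hbet
  exact sVanishesOnPairs_of_towerEngine_of_puncturedPairSpheresEmbedIn hengine ho

/-- **CALIBRATION: `SmoothPoincare4` implies the bet for EVERY orientation `o`** (height `0`: under SPC4 the pair
sphere `X ≃ₕ S⁴` is diffeomorphic to `S⁴`, so `(X, oX)` is itself an `o`-tower of height `0` and the inclusion of
the puncture is the required orientation-preserving embedding; none of the pair data is used).  Hence the bet is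
sandwiched `SPC4 ⇒ (∀ o, bet o) ⇒ (∃ o, bet o) ⇒ crux` (the last arrow mod MMSW Cor. 1.9), and refuting it for
either `o` exhibits a closed smooth homotopy 4-sphere not diffeomorphic to `S⁴`.
[cite: ManolescuPiccirillo2023, §1 p. 1] [cite: Kirby1997, Problem 4.89] -/
theorem puncturedPairSpheresEmbedIn_of_spc4 (hS : _root_.SmoothPoincare4)
    (o : SmoothOrientation (𝓡 4) ComplexProjectivePlane) : PuncturedPairSpheresEmbedIn o := by
  intro K K' g X _ _ _ _ _ _ e f j oX q hX _ _ _ _ _ _ _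
  obtain ⟨h⟩ := hX
  obtain ⟨φ⟩ := hS X ‹_› ‹_› h
  exact ⟨0, X, _, ‹_›, ‹_›, _, ‹_›, ‹_›, oX, Subtype.val, ⟨φ⟩, Manifold.IsSmoothEmbedding.of_opens _,
    isOrientationPreserving_subtype_val oX _⟩

/-- **Summary of the line's position, kernel-checked**: given the engine, `SmoothPoincare4 ⇒ crux` THROUGH the bet
(compare `Negative.sVanishesOnPairs_of_spc4`, which goes through Rasmussen's slice theorem instead).
[cite: ManolescuMarengonSarkarWillis2023, Cor. 1.9] -/
theorem sVanishesOnPairs_of_towerEngine_of_spc4 (hengine : Knot.rasmussen_nonpos_of_isTowerSlice)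
    (hS : _root_.SmoothPoincare4) : Literature.Uncategorized.SVanishesOnPairs := by
  obtain ⟨o, _⟩ := id hengine
  exact sVanishesOnPairs_of_towerEngine_of_puncturedPairSpheresEmbedIn hengine (puncturedPairSpheresEmbedIn_of_spc4 hS o)

end Summit.SmoothPoincare4.SmoothPoincare4.Theorems.ZseSVanishesOnPairs

end
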